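import Summits.HodgeConjecture.HodgeCM.Model.ArchKTypeOfCentralWeight_1

/-! PORT of `HodgeCM/Model/ArchKTypeOfCentralWeight.lean` (HodgeCMPerL run 82) — part 2: continuation of `Summits.HodgeConjecture.HodgeCM.Model.ArchKTypeOfCentralWeight_1` (split at a top-level declaration boundary by port_pkg.py; scope re-opened below; declarations unchanged). -/

-- port_pkg: scope re-opened for this part (file-level context, then the namespace/section stack open at the cut)
set_option autoImplicit false
noncomputable section
open NumberField NumberField.InfinitePlace NumberField.mixedEmbedding IsDedekindDomain
open scoped Matrix TensorProduct Classical SchwartzMap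
open MulAction
open Literature.Geometry.ComplexHyperbolic.BallModel (U21 x₀ stabilizerEquivK21 blockK blockU bmat mat_blockU)
open Literature.NumberTheory.Automorphic.U21 (K21 matA sclD)
open Literature.AlgebraicGeometry.ShimuraVarieties Literature.AlgebraicGeometry.ShimuraVarieties.BallForms
open Literature.NumberTheory.Automorphic Literature.NumberTheory.Automorphic.UnitaryGroup Literature.NumberTheory.Weil1964
open Literature.RepresentationTheory.KonnoKonno2007 Literature.RepresentationTheory.KonnoKonno2007.RealDualPair
open Literature.NumberTheory.GelbartRogawski1991 Literature.NumberTheory.GelbartRogawski1991.UnitaryDualPair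
open Literature.Analysis.SegalBargmann
open HodgeCM.Adelic HodgeCM.PerL34 HodgeCM.Model.HypCensus HodgeCM.Model.SupplyInstance
namespace HodgeCM.Model.ArchSideTerm
variable {L : CMField} {ι₁ : L →+* ℂ} (V : HermSpace3 L ι₁) (S : StubTree.SeesawDatum L)
variable
  (hGR : (cmSplittingDatum (L : Type) finProdFinEquiv (frameD V) (frameD_real V) (frameD_ne V) (dW S) (dW_real S) (dW_ne S)).CompatibleSplitting)
  (hGR₀ : (cmSplittingDatum (L : Type) (e₁) (frameD V) (frameD_real V) (frameD_ne V) (lineVec (L : Type) (dW S 0))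
    (fun _ => dW_real S 0) (fun _ => dW_ne S 0)).CompatibleSplitting)
  (hGR₁ : (cmSplittingDatum (L : Type) (e₁) (frameD V) (frameD_real V) (frameD_ne V) (lineVec (L : Type) (dW S 1))
    (fun _ => dW_real S 1) (fun _ => dW_ne S 1)).CompatibleSplitting)
  (hGR₂ : (cmSplittingDatum (L : Type) (e₁) (frameD V) (frameD_real V) (frameD_ne V) (lineVec (L : Type) (dW' S 0))
    (fun _ => dW'_real S 0) (fun _ => dW'_ne S 0)).CompatibleSplitting)
  (hGR₃ : (cmSplittingDatum (L : Type) (e₁) (frameD V) (frameD_real V) (frameD_ne V) (lineVec (L : Type) (dW' S 1))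
    (fun _ => dW'_real S 1) (fun _ => dW'_ne S 1)).CompatibleSplitting)
  (η₀ η₁ η₂ η₃ : CMAdelic (L : Type) (frameD V) × CMAdelicOne (L : Type) →* ℂˣ)
section CenterSplit
variable (L : Type) [Field L] [NumberField L] [IsCMField L] (ι₁ : L →+* ℂ)
/-- `z̄ · z = 1` for the `w(ι₁)`-coordinate of a norm-one unit. -/
theorem star_centerCoord_mul_self (t : ↥(Literature.NumberTheory.Automorphic.relNormOneInfUnits (↥(maximalRealSubfield L)) L)) :
    starRingEnd ℂ (centerCoord L ι₁ t) * centerCoord L ι₁ t = 1 := by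
  have h := congrArg (UnitaryGroup.evalC L (UnitaryGroup.cmPlace L ι₁))
    (UnitaryGroup.conjMixed_mul_self_eq_one (↥(maximalRealSubfield L)) L (IsCMField.complexConj L)
      (Algebra.IsQuadraticExtension.finrank_eq_two _ L) (IsCMField.complexConj_ne_one (K := L)) t)
  rw [map_mul, map_one, UnitaryGroup.evalC_conjMixed _ _ _ (NumberField.complexConj_smul_infinitePlace L _)
    (IsCMField.complexConj_ne_one (K := L))] at h
  exact h

/-- **`z_t ∈ U(1)`**: the `w(ι₁)`-coordinate of `t`, un-twisted by `embTwist` (so that the `ι₁`-section puts it back). -/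
def centerUnit (t : ↥(Literature.NumberTheory.Automorphic.relNormOneInfUnits (↥(maximalRealSubfield L)) L)) : unitary ℂ :=
  ⟨UnitaryGroup.embTwist L ι₁ (centerCoord L ι₁ t), by
    rw [Unitary.mem_iff, Complex.star_def, ← UnitaryGroup.embTwist_conj, ← map_mul, star_centerCoord_mul_self, map_one, mul_comm,
      ← map_mul, star_centerCoord_mul_self, map_one]
    exact ⟨rfl, rfl⟩⟩

/-- (Ported verbatim from the HodgeCMPerL package; no docstring in the source.) -/
theorem coe_centerUnit (t : ↥(Literature.NumberTheory.Automorphic.relNormOneInfUnits (↥(maximalRealSubfield L)) L)) :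
    (centerUnit L ι₁ t : ℂ) = UnitaryGroup.embTwist L ι₁ (centerCoord L ι₁ t) := rfl

/-- **the central element `z_t · 1 ∈ K = Stab(x₀) ⊂ U(2,1)`** attached to `t`. -/
def centerK (t : ↥(Literature.NumberTheory.Automorphic.relNormOneInfUnits (↥(maximalRealSubfield L)) L)) : stabilizer U21 x₀ :=
  blockK (centralK (centerUnit L ι₁ t))

/-- (Ported verbatim from the HodgeCMPerL package; no docstring in the source.) -/
theorem centerK_def (t : ↥(Literature.NumberTheory.Automorphic.relNormOneInfUnits (↥(maximalRealSubfield L)) L)) :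
    centerK L ι₁ t = blockK (centralK (centerUnit L ι₁ t)) := rfl

end CenterSplit

/-! #### § 3c. Components at `w(ι₁)`: the centre and the `ι₁`-section at `z_t · 1` agree; the away factor -/

section Components

variable {L : CMField} {ι₁ : L →+* ℂ} (V : HermSpace3 L ι₁)

/-- the `w(ι₁)`-component of the archimedean centre `t · 1₃` of `U(H)(L ⊗ ℝ)` is the scalar `z_t⁰ · 1₃`, `z_t⁰ = centerCoord t`. -/
theorem coe_archAt_cmArchCenter_apply (H : Matrix (Fin 3) (Fin 3) (L : Type))
    (t : ↥(Literature.NumberTheory.Automorphic.relNormOneInfUnits (↥(maximalRealSubfield L)) L)) (i j : Fin 3) :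
    (((UnitaryGroup.archAt (↥(maximalRealSubfield L)) L (IsCMField.complexConj L) 3 H (UnitaryGroup.cmPlace (L : Type) ι₁)
        (NumberField.complexConj_smul_infinitePlace (L : Type) _) (IsCMField.complexConj_ne_one (L : Type))
        (cmArchCenter (L : Type) 3 H t) : UnitaryGroup.archLocal (L : Type) 3 H (UnitaryGroup.cmPlace (L : Type) ι₁)) :
          GL (Fin 3) ℂ) : Matrix (Fin 3) (Fin 3) ℂ) i j =
      if i = j then centerCoord (L : Type) ι₁ t else 0 := by
  rw [UnitaryGroup.coe_archAt_apply, UnitaryGroup.cmArchCenter_eq, UnitaryGroup.coe_archCenter, Matrix.smul_apply, Matrix.one_apply,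
    smul_eq_mul, mul_ite, mul_one, mul_zero]
  split_ifs <;> rfl

/-- conjugating the scalar `z · 1₃` inside `GL₃(ℂ)` gives `z · 1₃`. -/
private theorem coe_conj_scalar (G T U : GL (Fin 3) ℂ) (z : ℂ) (hU : ((U : GL (Fin 3) ℂ) : Matrix (Fin 3) (Fin 3) ℂ) = z • 1) :
    ((G⁻¹ * (T * U * T⁻¹) * G : GL (Fin 3) ℂ) : Matrix (Fin 3) (Fin 3) ℂ) = z • 1 := by
  simp only [Units.val_mul, hU, Matrix.mul_smul, Matrix.smul_mul, Matrix.mul_one, Units.mul_inv, Units.inv_mul]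

/-- the `w(ι₁)`-component of the `ι₁`-section at the central element `z · 1 ∈ K ⊂ U(2,1)` is the scalar `embTwist(z) · 1₃`. -/
theorem coe_archAt_archSectionFrameOf_centralK_apply (z : unitary ℂ) (i j : Fin 3) :
    (((UnitaryGroup.archAt (↥(maximalRealSubfield L)) L (IsCMField.complexConj L) 3 (Matrix.diagonal (frameD V))
        (UnitaryGroup.cmPlace (L : Type) ι₁)
        (NumberField.complexConj_smul_infinitePlace (L : Type) _) (IsCMField.complexConj_ne_one (L : Type))
        (archSectionFrameOf V ((blockK (centralK z) : stabilizer U21 x₀) : U21)) :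
          UnitaryGroup.archLocal (L : Type) 3 (Matrix.diagonal (frameD V)) (UnitaryGroup.cmPlace (L : Type) ι₁)) :
            GL (Fin 3) ℂ) : Matrix (Fin 3) (Fin 3) ℂ) i j =
      if i = j then UnitaryGroup.embTwist (L : Type) ι₁ (z : ℂ) else 0 := by
  rw [coe_archAt_archSectionFrameOf_cmPlace', Matrix.GeneralLinearGroup.map_apply]
  have h := coe_conj_scalar (Matrix.GeneralLinearGroup.map ι₁ (frameG V)) V.sylvesterFrame
    (((blockK (centralK z) : stabilizer U21 x₀) : U21) : GL (Fin 3) ℂ) (z : ℂ) (coe_blockU_centralK z)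
  have h2 := congrFun (congrFun h i) j
  rw [h2, Matrix.smul_apply, Matrix.one_apply, smul_eq_mul, mul_ite, mul_one, mul_zero]
  by_cases hij : i = j
  · rw [if_pos hij, if_pos hij]
  · rw [if_neg hij, if_neg hij, map_zero]

variable (t : ↥(Literature.NumberTheory.Automorphic.relNormOneInfUnits (↥(maximalRealSubfield L)) L))

/-- **at `w(ι₁)` the `ι₁`-section at `z_t · 1` IS the archimedean centre `t · 1₃`.** -/
theorem archAt_archSectionFrameOf_centerK :
    UnitaryGroup.archAt (↥(maximalRealSubfield L)) L (IsCMField.complexConj L) 3 (Matrix.diagonal (frameD V))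
        (UnitaryGroup.cmPlace (L : Type) ι₁)
        (NumberField.complexConj_smul_infinitePlace (L : Type) _) (IsCMField.complexConj_ne_one (L : Type))
        (archSectionFrameOf V ((centerK (L : Type) ι₁ t : stabilizer U21 x₀) : U21)) =
      UnitaryGroup.archAt (↥(maximalRealSubfield L)) L (IsCMField.complexConj L) 3 (Matrix.diagonal (frameD V))
        (UnitaryGroup.cmPlace (L : Type) ι₁)
        (NumberField.complexConj_smul_infinitePlace (L : Type) _) (IsCMField.complexConj_ne_one (L : Type))
        (cmArchCenter (L : Type) 3 (Matrix.diagonal (frameD V)) t) := by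
  refine Subtype.ext (Units.ext (Matrix.ext fun i j => ?_))
  rw [centerK_def, coe_archAt_archSectionFrameOf_centralK_apply, coe_archAt_cmArchCenter_apply, coe_centerUnit, UnitaryGroup.embTwist_embTwist]

/-- **the away factor of the centre**: `(ι₁-section at z_t · 1)⁻¹ · (t · 1₃)`. -/
def centerAway : UnitaryGroup.arch (↥(maximalRealSubfield L)) L (IsCMField.complexConj L) 3 (Matrix.diagonal (frameD V)) :=
  (archSectionFrameOf V ((centerK (L : Type) ι₁ t : stabilizer U21 x₀) : U21))⁻¹ * cmArchCenter (L : Type) 3 (Matrix.diagonal (frameD V)) t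

/-- **the split**: `t · 1₃ = (ι₁-section at z_t · 1) · (away factor)`. -/
theorem cmArchCenter_eq_archSectionFrameOf_mul_centerAway :
    cmArchCenter (L : Type) 3 (Matrix.diagonal (frameD V)) t =
      archSectionFrameOf V ((centerK (L : Type) ι₁ t : stabilizer U21 x₀) : U21) * centerAway V t := by
  rw [centerAway, mul_inv_cancel_left]

/-- **the away factor is trivial at `w(ι₁)`.** -/
theorem archAt_centerAway :
    UnitaryGroup.archAt (↥(maximalRealSubfield L)) L (IsCMField.complexConj L) 3 (Matrix.diagonal (frameD V))
        (UnitaryGroup.cmPlace (L : Type) ι₁)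
        (NumberField.complexConj_smul_infinitePlace (L : Type) _) (IsCMField.complexConj_ne_one (L : Type))
        (centerAway V t) = 1 := by
  rw [centerAway, map_mul, map_inv, archAt_archSectionFrameOf_centerK, inv_mul_cancel]

/-- **`(t · 1₃)^𝔸 = u_t · 1_V`** (tree `archToAdelic_cmArchCenter`, read with the CM-pair `CMCenter`). -/
theorem archToAdelic_cmArchCenter_frameD :
    UnitaryGroup.archToAdelic (↥(maximalRealSubfield L)) L (IsCMField.complexConj L) 3 (Matrix.diagonal (frameD V))
        (cmArchCenter (L : Type) 3 (Matrix.diagonal (frameD V)) t) =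
      CMCenter (L : Type) (frameD V) ((UnitaryGroup.cmAdelicOneEquivRelNormOne (L : Type)).symm
        (Literature.NumberTheory.Automorphic.relNormOneInfToIdeles (↥(maximalRealSubfield L)) L t)) :=
  UnitaryGroup.archToAdelic_cmArchCenter (L : Type) 3 (Matrix.diagonal (frameD V)) t

end Components

end HodgeCM.Model.ArchSideTerm

end
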